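import Summits.CriticalPhenomena.PercolationContinuityZ3.Theorems.PercNearOneGluingNoHeavyQuantLawDecFlows
import Summits.CriticalPhenomena.PercolationContinuityZ3.Theorems.PercNearOneGluingNoHeavyQuantBlobDecTwoCerts
import HarnessLib

/-!
# QUANT lane R8, depth-2 closure (D2) in the RELAY case: the analytic core of the ONE-ROW certificate —
# the relay capacity inequality for `LawDec.pairGate` / `LawDec.usage`

builds on p205010 (kernel theorem, internal audit signed; external expert review pending)

Support file (`--supports stmt-CriticalPhenomena-4575`), QUANT lane seat prim-quant-census-2 (gen 67), rung R8 of
`run/shared/lean/prim/quant/LADDER.md`; census memo `run/shared/lean/prim/quant/prim-quant-census-2-g67/DEPTH2-CLOSURE-G67.md` §4.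
Theorems only (no definitions), standard axioms, no sorries; imports `…QuantLawDecFlows` (typer g22: `LawDec.pairGate`, `LawDec.usage`) and
`…QuantBlobDecTwoCerts` (census-2 g49: the two regimes `BlobDec2.gate_eq_heavy` / `gate_eq_light` of the minimal gate).

THE CONTEXT.  D2 (census-2 g64–g66; lane STATEMENTS §AJ) asks that the depth-≤2 row class {`LawDec.TLB`, `LawDec.TLC`, `LawDec.TLC2`} of two
top-affordable gated factors pass to the gated convolution.  In the RELAY case (second factor `{0: 1−g, 1: g}`, gate `g ≥ y` = its own
top-affordability, `q = 1`) a product row with coefficient vector `c′` on `{0..M+1}` (target `T + g`) reads on the big factor `μ` (target `T`) as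
`Σ_a μ(a)·e(a)` with the PULL-BACK `e(a) = (1−g)·c′(a) + g·c′(a+1)`.  Census-2 g67's exact census (memo §4b: 495 695 instances, floors `.2 … .9`,
any target, `g ∈ [y,1]`, 0 exceptions) found that for every single-threshold product row `TLCR′(j′, i′)` (`i′ ≥ 1` a factor low) the pull-back is
dominated COEFFICIENTWISE by ONE two-threshold factor row `TLC2_T(j*, i′−1, i′, θ₀)` with `θ₀ = min(1−g, s/(s+g))`, `s = T − 2i′`, and the layer rule
`j* = j′ − 1` if `j′` is a cheap product mid for `i′`, else `j* = j′` — the relay case of the G₁-third of D2, one depth above G₀'s relay lemma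
(`…QuantDepthOneRelayRow`, ✓ p377094).  On the lows and the giants that domination is bookkeeping; on a mid `a` of the factor row it is EXACTLY the
inequality of this file between the capacities `cap = 1/usage = 1/pairGate − 1` of the pair `(i′, a)` at the two targets:

  `min(1−g, s/(s+g)) · cap_T(i′, a)  ≤  (1−g) · cap_{T+g}(i′, a) + g · cap_{T+g}(i′, a+1)`        (interior mid, `relay_cap_pairGate`)
  `min(1−g, s/(s+g)) · cap_T(i′, a)  ≤  (1−g) · cap_{T+g}(i′, a) + g · (1−y)/y`                     (the layer endpoint `a = j′ = j*`, where the
                                                                                                     shifted copy sees a giant; valid when the pair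
                                                                                                     `(i′, a)` is NOT cheap at `T+g`: `relay_cap_pairGate_top`)

(capacities of incompatible pairs clipped at `0`).  In the linear regime of `pairGate` (all minimal gates `≥ y`) the first is the IDENTITY
`(1−g)·cap_{T+g}(i′,a) + g·cap_{T+g}(i′,a+1) = (s/(s+g))·cap_T(i′,a)` (`cap_τ(t,h) = (t+h−τ)/(τ−2t)` there); the content is the cheap regime, where
`pairGate = y² + (1−y)ρ`.  PROOF (memo §4b): with `ρ₄ = s/n ≤ ρ₁ = (s+g)/n`, `ρ₂ = (s+g)/(n+1)` (`n = a − i′ > s`) and `g ≥ y`: `ρ₄ ≥ y` forces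
`ρ₂ ≥ y` (linear identity); `ρ₄ < y ≤ ρ₂`: `1/pairGate ≤ 1/ρ`; `ρ₂ < y ≤ ρ₁`: `ρ₄ ≤ ρ₂` and `(ny − s) ≥ g((n+1)y − s − g)`, two exact defect identities;
all three below `y`: `(s+g)·D₄ − s·D₁ = g·y²` and `D₁, D₄ < y`; the endpoint: `y²(ny−s) − g((n+1)y−s−g)·D₄ = y(1−y)(ny−s)²/n + (g−y)(s+g−ny)·D₄ ≥ 0`.
Stated first for real `s, n` (`relay_cap_core`, `relay_cap_core_top`), then for `LawDec.pairGate` at the three pairs, and `one_div_usage_of_le_layer`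
rewrites `1/usage` of a mid as `1/pairGate − 1` for the row bookkeeping of the one-row lemma (next file, arm-2 / census-2).
EXACT CHECKS: `local/local_ineqB.py` (1 875 984 rational grid points incl. real `n`, worst margin exactly `0`), `local_caseEnd.py` (endpoint defect,
1 179 652 points, min `4·10⁻⁹ > 0`), and the row-level census above.  HONEST STATUS: D2, G₁, `Quant.FarTreeRow` (light) remain OPEN; this file is one
real inequality; nothing here is cited as a published result; the lane's RATE class log\* and honest sentence (`run/shared/lean/prim/quant/README.md`)
are unchanged.

[this work]; minimal gates / usage: prim-quant-stmt g22 (`…QuantLawDecFlows`); the depth-2 rows: prim-quant-census-2 g64 (`…QuantDepthTwoRows`); the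
G₀ relay lemma this parallels: prim-quant-census-2 g64 (`…QuantDepthOneRelayRow`).  The gluing rows served [cite: KozmaNitzan2024, Conjecture 3 (p. 15)];
product measure [cite: Grimmett1999, §1.3 p. 10].
-/

noncomputable section

namespace Summit.CriticalPhenomena.PercolationContinuityZ3.Theorems

namespace Quant

namespace LawDec

/-! ### The core inequality for real parameters

(the two regimes of the minimal gate `max(ρ, y² + (1−y)ρ)` are `BlobDec2.gate_eq_heavy` / `BlobDec2.gate_eq_light` of
`…QuantBlobDecTwoCerts`, census-2 g49) -/

/-- **THE RELAY CAPACITY INEQUALITY, interior form** (real parameters).  `0 < y < 1`, `y ≤ g ≤ 1`, `0 < s < n`; with the clipped capacity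
`c⁺(ρ) = max 0 (1/max(ρ, y²+(1−y)ρ) − 1)`:
`min(1−g, s/(s+g)) · c⁺(s/n) ≤ (1−g) · c⁺((s+g)/n) + g · c⁺((s+g)/(n+1))`. [this work] -/
theorem relay_cap_core (y g s n : ℝ) (hy0 : 0 < y) (hy1 : y < 1) (hyg : y ≤ g) (hg1 : g ≤ 1) (hs : 0 < s) (hsn : s < n) :
    min (1 - g) (s / (s + g)) * max 0 (1 / max (s / n) (y ^ 2 + (1 - y) * (s / n)) - 1)
      ≤ (1 - g) * max 0 (1 / max ((s + g) / n) (y ^ 2 + (1 - y) * ((s + g) / n)) - 1)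
        + g * max 0 (1 / max ((s + g) / (n + 1)) (y ^ 2 + (1 - y) * ((s + g) / (n + 1))) - 1) := by
  have hn : 0 < n := lt_trans hs hsn
  have hn1 : 0 < n + 1 := by linarith
  have hg0 : 0 < g := lt_of_lt_of_le hy0 hyg
  have hA : 0 < s + g := by linarith
  have h1g : 0 ≤ 1 - g := by linarith
  have hn0 : n ≠ 0 := hn.ne'
  have hn10 : n + 1 ≠ 0 := hn1.ne'
  have hs0 : s ≠ 0 := hs.ne'
  have hA0 : s + g ≠ 0 := hA.ne'
  -- the multiplier θ₀ = min(1−g, s/(s+g))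
  have hθA : min (1 - g) (s / (s + g)) ≤ s / (s + g) := min_le_right _ _
  -- the linear values: (1−g)(n/(s+g) − 1) + g((n+1)/(s+g) − 1) = (n − s)/(s+g) = (s/(s+g))·(n/s − 1)
  have hlin : (1 - g) * (n / (s + g) - 1) + g * ((n + 1) / (s + g) - 1) = (n - s) / (s + g) := by
    field_simp
    ring
  have hsA : s / (s + g) * (n / s - 1) = (n - s) / (s + g) := by
    field_simp
  rcases le_or_gt y (s / n) with h4 | h4
  · ----------------------------------------------------------------- Case I: the pair (i′, a) is expensive at target T
    -- then so are both pairs at target T + g (uses g ≥ y)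
    have h1 : y ≤ (s + g) / n := le_trans h4 (div_le_div_of_nonneg_right (by linarith) hn.le)
    have hsn' : y * n ≤ s := by rwa [le_div_iff₀ hn] at h4
    have h2 : y ≤ (s + g) / (n + 1) := by rw [le_div_iff₀ hn1]; linarith
    rw [BlobDec2.gate_eq_heavy y _ hy0.le h4, BlobDec2.gate_eq_heavy y _ hy0.le h1, BlobDec2.gate_eq_heavy y _ hy0.le h2,
      one_div_div, one_div_div, one_div_div]
    have hc4 : max 0 (n / s - 1) = n / s - 1 := max_eq_right (by rw [sub_nonneg, le_div_iff₀ hs]; linarith)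
    rw [hc4]
    have e1 : (1 - g) * (n / (s + g) - 1) ≤ (1 - g) * max 0 (n / (s + g) - 1) :=
      mul_le_mul_of_nonneg_left (le_max_right _ _) h1g
    have e2 : g * ((n + 1) / (s + g) - 1) ≤ g * max 0 ((n + 1) / (s + g) - 1) :=
      mul_le_mul_of_nonneg_left (le_max_right _ _) hg0.le
    have e3 : min (1 - g) (s / (s + g)) * (n / s - 1) ≤ s / (s + g) * (n / s - 1) :=
      mul_le_mul_of_nonneg_right hθA (by rw [sub_nonneg, le_div_iff₀ hs]; linarith)
    linarith [hlin, hsA]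
  · ----------------------------------------------------------------- Case II: the pair (i′, a) is cheap at target T
    rw [BlobDec2.gate_eq_light y _ hy0.le h4.le]
    have hw : 0 < n * y - s := by
      have : s < y * n := by rwa [div_lt_iff₀ hn] at h4
      linarith
    rcases le_or_gt y ((s + g) / (n + 1)) with h2 | h2
    · --------------------------------------------------------------- IIa: both pairs at T + g expensive — linear right side
      have h1 : y ≤ (s + g) / n :=
        le_trans h2 (div_le_div_of_nonneg_left hA.le hn (by linarith))
      rw [BlobDec2.gate_eq_heavy y _ hy0.le h1, BlobDec2.gate_eq_heavy y _ hy0.le h2, one_div_div, one_div_div]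
      set D4 : ℝ := y ^ 2 + (1 - y) * (s / n) with hD4def
      clear_value D4
      have h1y : (0 : ℝ) < 1 - y := by linarith
      have hsn0 : 0 < s / n := div_pos hs hn
      have hD4ge : s / n ≤ D4 := by
        have e : D4 - s / n = y * (y - s / n) := by rw [hD4def]; ring
        have hp := mul_nonneg hy0.le (sub_nonneg.2 h4.le)
        linarith [e, hp]
      have hD4 : 0 < D4 := lt_of_lt_of_le hsn0 hD4ge
      have hD4y : D4 < y := by
        have e : y - D4 = (1 - y) * (y - s / n) := by rw [hD4def]; ring
        have hp := mul_pos h1y (sub_pos.2 h4)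
        linarith [e, hp]
      have hc4pos : 0 ≤ 1 / D4 - 1 := by
        rw [sub_nonneg, le_div_iff₀ hD4]; linarith
      rw [max_eq_right hc4pos]
      have hc4lin : 1 / D4 - 1 ≤ n / s - 1 := by
        have := one_div_le_one_div_of_le (div_pos hs hn) hD4ge
        rw [one_div_div] at this
        linarith
      have e1 : (1 - g) * (n / (s + g) - 1) ≤ (1 - g) * max 0 (n / (s + g) - 1) :=
        mul_le_mul_of_nonneg_left (le_max_right _ _) h1g
      have e2 : g * ((n + 1) / (s + g) - 1) ≤ g * max 0 ((n + 1) / (s + g) - 1) :=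
        mul_le_mul_of_nonneg_left (le_max_right _ _) hg0.le
      have e3 : min (1 - g) (s / (s + g)) * (1 / D4 - 1) ≤ s / (s + g) * (n / s - 1) :=
        mul_le_mul hθA hc4lin hc4pos (div_pos hs hA).le
      linarith [hlin, hsA]
    · --------------------------------------------------------------- IIb / IIc: the shifted pair at T + g is cheap
      rw [BlobDec2.gate_eq_light y _ hy0.le h2.le]
      have h1y : (0 : ℝ) < 1 - y := by linarith
      have hrel4 : n * (y ^ 2 + (1 - y) * (s / n)) = n * y ^ 2 + (1 - y) * s := by field_simp
      have hrel2 : (n + 1) * (y ^ 2 + (1 - y) * ((s + g) / (n + 1))) = (n + 1) * y ^ 2 + (1 - y) * (s + g) := by field_simp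
      have hρ42 : s / n ≤ (s + g) / (n + 1) := by
        rw [div_le_div_iff₀ hn hn1]
        nlinarith [mul_le_mul_of_nonneg_right hyg hn.le]
      set D4 : ℝ := y ^ 2 + (1 - y) * (s / n) with hD4def
      set D2 : ℝ := y ^ 2 + (1 - y) * ((s + g) / (n + 1)) with hD2def
      clear_value D4 D2
      have hD4pos' : 0 < s / n := div_pos hs hn
      have hD4 : 0 < D4 := by rw [hD4def]; exact add_pos (pow_pos hy0 2) (mul_pos h1y (div_pos hs hn))
      have hD2 : 0 < D2 := by rw [hD2def]; exact add_pos (pow_pos hy0 2) (mul_pos h1y (div_pos hA hn1))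
      have hD40 : D4 ≠ 0 := hD4.ne'
      have hD20 : D2 ≠ 0 := hD2.ne'
      have hD4y : D4 < y := by
        have e : y - D4 = (1 - y) * (y - s / n) := by rw [hD4def]; ring
        have hp := mul_pos h1y (sub_pos.2 h4)
        linarith [e, hp]
      have hD2y : D2 < y := by
        have e : y - D2 = (1 - y) * (y - (s + g) / (n + 1)) := by rw [hD2def]; ring
        have hp := mul_pos h1y (sub_pos.2 h2)
        linarith [e, hp]
      have hD42 : D4 ≤ D2 := by
        have e : D2 - D4 = (1 - y) * ((s + g) / (n + 1) - s / n) := by rw [hD4def, hD2def]; ring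
        have hp := mul_nonneg h1y.le (sub_nonneg.2 hρ42)
        linarith [e, hp]
      have hc4pos : 0 ≤ 1 / D4 - 1 := by
        rw [sub_nonneg, le_div_iff₀ hD4]; linarith
      have hc2pos : 0 ≤ 1 / D2 - 1 := by
        rw [sub_nonneg, le_div_iff₀ hD2]; linarith
      rw [max_eq_right hc4pos, max_eq_right hc2pos]
      have hv : 0 < (n + 1) * y - (s + g) := by
        have : s + g < y * (n + 1) := by rwa [div_lt_iff₀ hn1] at h2
        linarith
      have e3 : min (1 - g) (s / (s + g)) * (1 / D4 - 1) ≤ s / (s + g) * (1 / D4 - 1) :=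
        mul_le_mul_of_nonneg_right hθA hc4pos
      have L : s / (s + g) * (1 / D4 - 1) = (s / D4 - s) / (s + g) := by
        field_simp
      have t4 : s / D4 = n - y * (n * y - s) / D4 := by
        rw [eq_sub_iff_add_eq, ← add_div, div_eq_iff hD40]
        linear_combination (-1 : ℝ) * hrel4
      rcases le_or_gt y ((s + g) / n) with h1 | h1
      · ------------------------------------------------------------- IIb: the unshifted pair at T + g is expensive
        rw [BlobDec2.gate_eq_heavy y _ hy0.le h1, one_div_div]
        have e1 : (1 - g) * (n / (s + g) - 1) ≤ (1 - g) * max 0 (n / (s + g) - 1) :=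
          mul_le_mul_of_nonneg_left (le_max_right _ _) h1g
        -- ρ₄ ≤ ρ₂ (from g ≥ y > s/n) gives D₄ ≤ D₂, and (ny − s) ≥ g((n+1)y − s − g)
        have hwv : g * ((n + 1) * y - (s + g)) ≤ n * y - s := by
          nlinarith [mul_nonneg h1g hw.le, mul_nonneg hg0.le (sub_nonneg.2 hyg)]
        have key : g * ((n + 1) * y - (s + g)) / D2 ≤ (n * y - s) / D4 := by
          rw [div_le_div_iff₀ hD2 hD4]
          calc g * ((n + 1) * y - (s + g)) * D4
              ≤ (n * y - s) * D4 := mul_le_mul_of_nonneg_right hwv hD4.le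
            _ ≤ (n * y - s) * D2 := mul_le_mul_of_nonneg_left hD42 hw.le
        have t2 : (s + g) / D2 = (n + 1) - y * ((n + 1) * y - (s + g)) / D2 := by
          rw [eq_sub_iff_add_eq, ← add_div, div_eq_iff hD20]
          linear_combination (-1 : ℝ) * hrel2
        have R : (1 - g) * (n / (s + g) - 1) + g * (1 / D2 - 1)
            = ((1 - g) * (n - (s + g)) + g * ((s + g) / D2) - g * (s + g)) / (s + g) := by
          field_simp
          ring
        have main : (s / D4 - s) / (s + g) ≤ ((1 - g) * (n - (s + g)) + g * ((s + g) / D2) - g * (s + g)) / (s + g) := by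
          refine div_le_div_of_nonneg_right ?_ hA.le
          rw [t4, t2]
          have hk := mul_le_mul_of_nonneg_left key hy0.le
          have e5 : y * (g * ((n + 1) * y - (s + g)) / D2) = g * (y * ((n + 1) * y - (s + g)) / D2) := by ring
          have e6 : y * ((n * y - s) / D4) = y * (n * y - s) / D4 := by ring
          linarith [hk, e5, e6]
        linarith [e3, e1, L, R, main]
      · ------------------------------------------------------------- IIc: all three pairs cheap
        rw [BlobDec2.gate_eq_light y _ hy0.le h1.le]
        have hrel1 : n * (y ^ 2 + (1 - y) * ((s + g) / n)) = n * y ^ 2 + (1 - y) * (s + g) := by field_simp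
        have hρ21 : (s + g) / (n + 1) ≤ (s + g) / n := div_le_div_of_nonneg_left hA.le hn (by linarith)
        set D1 : ℝ := y ^ 2 + (1 - y) * ((s + g) / n) with hD1def
        clear_value D1
        have hD1 : 0 < D1 := by rw [hD1def]; exact add_pos (pow_pos hy0 2) (mul_pos h1y (div_pos hA hn))
        have hD10 : D1 ≠ 0 := hD1.ne'
        have hD1y : D1 < y := by
          have e : y - D1 = (1 - y) * (y - (s + g) / n) := by rw [hD1def]; ring
          have hp := mul_pos h1y (sub_pos.2 h1)
          linarith [e, hp]
        have hc1pos : 0 ≤ 1 / D1 - 1 := by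
          rw [sub_nonneg, le_div_iff₀ hD1]; linarith
        rw [max_eq_right hc1pos]
        -- D₂ ≤ D₁, the identity (s+g)·D₄ − s·D₁ = g·y², and D₁·D₄ ≤ y²
        have hD21 : D2 ≤ D1 := by
          have e : D1 - D2 = (1 - y) * ((s + g) / n - (s + g) / (n + 1)) := by rw [hD1def, hD2def]; ring
          have hp := mul_nonneg h1y.le (sub_nonneg.2 hρ21)
          linarith [e, hp]
        have hid : (s + g) * D4 - D1 * s = g * y ^ 2 := by
          have h' : n * ((s + g) * D4 - D1 * s) = n * (g * y ^ 2) := by linear_combination (s + g) * hrel4 - s * hrel1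
          exact mul_left_cancel₀ hn0 h'
        have hprod : D1 * D4 ≤ y ^ 2 := by
          rw [sq]; exact mul_le_mul hD1y.le hD4y.le hD4.le hy0.le
        have hAD2 : (s + g) / D1 ≤ (s + g) / D2 := div_le_div_of_nonneg_left hA.le hD2 hD21
        have hgap : g ≤ (s + g) / D1 - s / D4 := by
          have e : (s + g) / D1 - s / D4 = g * y ^ 2 / (D1 * D4) := by
            rw [div_sub_div _ _ hD10 hD40, hid]
          rw [e, le_div_iff₀ (mul_pos hD1 hD4)]
          exact mul_le_mul_of_nonneg_left hprod hg0.le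
        have R : (1 - g) * (1 / D1 - 1) + g * (1 / D2 - 1)
            = ((1 - g) * ((s + g) / D1) + g * ((s + g) / D2) - (s + g)) / (s + g) := by
          field_simp
          ring
        have main : (s / D4 - s) / (s + g) ≤ ((1 - g) * ((s + g) / D1) + g * ((s + g) / D2) - (s + g)) / (s + g) := by
          refine div_le_div_of_nonneg_right ?_ hA.le
          linarith [mul_le_mul_of_nonneg_left hAD2 hg0.le, hgap]
        linarith [e3, L, R, main]

/-- **THE RELAY CAPACITY INEQUALITY, endpoint form** (real parameters): as `relay_cap_core` with the shifted-pair term replaced by the giant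
rate `g·(1−y)/y`, valid when the unshifted pair at the raised target is NOT cheap (`y ≤ (s+g)/n`). [this work] -/
theorem relay_cap_core_top (y g s n : ℝ) (hy0 : 0 < y) (hy1 : y < 1) (hyg : y ≤ g) (hg1 : g ≤ 1) (hs : 0 < s) (hsn : s < n)
    (htop : y ≤ (s + g) / n) :
    min (1 - g) (s / (s + g)) * max 0 (1 / max (s / n) (y ^ 2 + (1 - y) * (s / n)) - 1)
      ≤ (1 - g) * max 0 (1 / max ((s + g) / n) (y ^ 2 + (1 - y) * ((s + g) / n)) - 1) + g * ((1 - y) / y) := by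
  have hn : 0 < n := lt_trans hs hsn
  have hn1 : 0 < n + 1 := by linarith
  have hg0 : 0 < g := lt_of_lt_of_le hy0 hyg
  have hA : 0 < s + g := by linarith
  have h1g : 0 ≤ 1 - g := by linarith
  have hn0 : n ≠ 0 := hn.ne'
  have hA0 : s + g ≠ 0 := hA.ne'
  have hy00 : y ≠ 0 := hy0.ne'
  have hθA : min (1 - g) (s / (s + g)) ≤ s / (s + g) := min_le_right _ _
  rcases le_or_gt y ((s + g) / (n + 1)) with h2 | h2
  · -- the shifted pair is expensive: its clipped capacity is at most the giant rate, so the interior form suffices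
    have hcap2 : max 0 (1 / max ((s + g) / (n + 1)) (y ^ 2 + (1 - y) * ((s + g) / (n + 1))) - 1) ≤ (1 - y) / y := by
      rw [BlobDec2.gate_eq_heavy y _ hy0.le h2, one_div_div]
      refine max_le (div_nonneg (by linarith) hy0.le) ?_
      have := one_div_le_one_div_of_le hy0 h2
      rw [one_div_div] at this
      have e : (1 - y) / y = 1 / y - 1 := by field_simp
      rw [e]; linarith
    have := relay_cap_core y g s n hy0 hy1 hyg hg1 hs hsn
    nlinarith [mul_le_mul_of_nonneg_left hcap2 hg0.le]
  · -- the shifted pair is cheap: then the pair at T is cheap too (s/n < y), and the endpoint defect identity applies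
    have h4 : s / n < y := by
      have hlt : (s + g) / (n + 1) < y := h2
      rw [div_lt_iff₀ hn1] at hlt
      rw [div_lt_iff₀ hn]
      linarith
    rw [BlobDec2.gate_eq_light y _ hy0.le h4.le, BlobDec2.gate_eq_heavy y _ hy0.le htop, one_div_div]
    have h1y : (0 : ℝ) < 1 - y := by linarith
    have hrel4 : n * (y ^ 2 + (1 - y) * (s / n)) = n * y ^ 2 + (1 - y) * s := by field_simp
    set D4 : ℝ := y ^ 2 + (1 - y) * (s / n) with hD4def
    clear_value D4
    have hD4 : 0 < D4 := by rw [hD4def]; exact add_pos (pow_pos hy0 2) (mul_pos h1y (div_pos hs hn))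
    have hD40 : D4 ≠ 0 := hD4.ne'
    have hD4y : D4 < y := by
      have e : y - D4 = (1 - y) * (y - s / n) := by rw [hD4def]; ring
      have hp := mul_pos h1y (sub_pos.2 h4)
      linarith [e, hp]
    have hc4pos : 0 ≤ 1 / D4 - 1 := by
      rw [sub_nonneg, le_div_iff₀ hD4]; linarith
    rw [max_eq_right hc4pos]
    have e1 : (1 - g) * (n / (s + g) - 1) ≤ (1 - g) * max 0 (n / (s + g) - 1) :=
      mul_le_mul_of_nonneg_left (le_max_right _ _) h1g
    have e3 : min (1 - g) (s / (s + g)) * (1 / D4 - 1) ≤ s / (s + g) * (1 / D4 - 1) :=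
      mul_le_mul_of_nonneg_right hθA hc4pos
    -- w = ny − s > 0, w ≤ g (from y ≤ (s+g)/n), v = (n+1)y − s − g > 0
    have hw : 0 < n * y - s := by
      have : s < y * n := by rwa [div_lt_iff₀ hn] at h4
      linarith
    have hwg : n * y - s ≤ g := by
      have : y * n ≤ s + g := by rwa [le_div_iff₀ hn] at htop
      linarith
    have hv : 0 < (n + 1) * y - (s + g) := by
      have : s + g < y * (n + 1) := by rwa [div_lt_iff₀ hn1] at h2
      linarith
    -- endpoint defect: g((n+1)y − s − g)·D₄ ≤ y²(ny − s)
    have key : g * ((n + 1) * y - (s + g)) * D4 ≤ y ^ 2 * (n * y - s) := by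
      have hsplit : g * ((n + 1) * y - (s + g)) = y * (n * y - s) - (g - y) * (g - (n * y - s)) := by ring
      rw [hsplit]
      have p1 : 0 ≤ (g - y) * (g - (n * y - s)) * D4 := mul_nonneg (mul_nonneg (by linarith) (by linarith)) hD4.le
      have p2 : y * (n * y - s) * D4 ≤ y * (n * y - s) * y :=
        mul_le_mul_of_nonneg_left hD4y.le (mul_nonneg hy0.le hw.le)
      linarith [p1, p2]
    have key' : g * ((n + 1) * y - (s + g)) / y ≤ y * (n * y - s) / D4 := by
      rw [div_le_div_iff₀ hy0 hD4]
      linarith [key]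
    have t4 : s / D4 = n - y * (n * y - s) / D4 := by
      rw [eq_sub_iff_add_eq, ← add_div, div_eq_iff hD40]
      linear_combination (-1 : ℝ) * hrel4
    have kexp : g * ((n + 1) * y - (s + g)) / y = g * (n + 1) - g * (s + g) / y := by
      field_simp
    have L : s / (s + g) * (1 / D4 - 1) = (s / D4 - s) / (s + g) := by
      field_simp
    have R : (1 - g) * (n / (s + g) - 1) + g * ((1 - y) / y)
        = ((1 - g) * (n - (s + g)) - g * (s + g) + g * (s + g) / y) / (s + g) := by
      field_simp
      ring
    have main : (s / D4 - s) / (s + g) ≤ ((1 - g) * (n - (s + g)) - g * (s + g) + g * (s + g) / y) / (s + g) := by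
      refine div_le_div_of_nonneg_right ?_ hA.le
      rw [t4]
      linarith [key', kexp]
    linarith [e3, e1, L, R, main]

/-! ### The same for `LawDec.pairGate` at the three pairs `(i′,a)_T`, `(i′,a)_{T+g}`, `(i′,a+1)_{T+g}` -/

/-- **RELAY CAPACITY INEQUALITY FOR THE MINIMAL GATES** (interior mid).  Floor `0 < y < 1`, relay gate `y ≤ g ≤ 1`, a factor low `i` (`2i < T`)
and an atom `a` compatible with it at target `T` (`T < i + a`).  With the clipped capacities `c⁺ = max 0 (1/pairGate − 1)`:
`min(1−g, (T−2i)/(T−2i+g)) · c⁺(pairGate y T i a) ≤ (1−g) · c⁺(pairGate y (T+g) i a) + g · c⁺(pairGate y (T+g) i (a+1))`. [this work] -/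
theorem relay_cap_pairGate (y T g : ℝ) (i a : ℕ) (hy0 : 0 < y) (hy1 : y < 1) (hyg : y ≤ g) (hg1 : g ≤ 1)
    (hlow : 2 * (i : ℝ) < T) (hcomp : T < (i : ℝ) + a) :
    min (1 - g) ((T - 2 * (i : ℝ)) / (T - 2 * (i : ℝ) + g)) * max 0 (1 / pairGate y T i a - 1)
      ≤ (1 - g) * max 0 (1 / pairGate y (T + g) i a - 1) + g * max 0 (1 / pairGate y (T + g) i (a + 1) - 1) := by
  have hcore := relay_cap_core y g (T - 2 * (i : ℝ)) ((a : ℝ) - i) hy0 hy1 hyg hg1 (by linarith) (by linarith)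
  unfold pairGate
  push_cast
  rw [show T + g - 2 * (i : ℝ) = T - 2 * (i : ℝ) + g by ring, show (a : ℝ) + 1 - i = (a : ℝ) - i + 1 by ring]
  exact hcore

/-- **RELAY CAPACITY INEQUALITY FOR THE MINIMAL GATES, layer endpoint**: as `relay_cap_pairGate` with the shifted pair replaced by the giant rate
`(1−y)/y`, valid when the pair `(i, a)` is not cheap at the raised target (`y ≤ (T+g−2i)/(a−i)`, i.e. `usage ≥ y/(1−y)` there). [this work] -/
theorem relay_cap_pairGate_top (y T g : ℝ) (i a : ℕ) (hy0 : 0 < y) (hy1 : y < 1) (hyg : y ≤ g) (hg1 : g ≤ 1)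
    (hlow : 2 * (i : ℝ) < T) (hcomp : T < (i : ℝ) + a) (htop : y ≤ (T + g - 2 * (i : ℝ)) / ((a : ℝ) - i)) :
    min (1 - g) ((T - 2 * (i : ℝ)) / (T - 2 * (i : ℝ) + g)) * max 0 (1 / pairGate y T i a - 1)
      ≤ (1 - g) * max 0 (1 / pairGate y (T + g) i a - 1) + g * ((1 - y) / y) := by
  have htop' : y ≤ (T - 2 * (i : ℝ) + g) / ((a : ℝ) - i) := by
    rwa [show T + g - 2 * (i : ℝ) = T - 2 * (i : ℝ) + g by ring] at htop
  have hcore := relay_cap_core_top y g (T - 2 * (i : ℝ)) ((a : ℝ) - i) hy0 hy1 hyg hg1 (by linarith) (by linarith) htop'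
  unfold pairGate
  rw [show T + g - 2 * (i : ℝ) = T - 2 * (i : ℝ) + g by ring]
  exact hcore

/-- **`1/usage` of a pair below the layer is `1/pairGate − 1`** (`h ≤ j`, minimal gate `≠ 0`): the capacity that the depth-1/2 rows
`LawDec.TLC` / `LawDec.TLC2` attach to a mid (`ν h / usage`, `cap2 = max(1/usage, θ/usage)`). [this work] -/
theorem one_div_usage_of_le_layer (x T : ℝ) (j l h : ℕ) (hh : h ≤ j) (hG : pairGate x T l h ≠ 0) :
    1 / usage x T j l h = 1 / pairGate x T l h - 1 := by
  have hnj : ¬ (j + 1 ≤ h) := by omega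
  simp only [usage, gateOf, if_neg hnj]
  rw [one_div_div, sub_div, div_self hG]

end LawDec

end Quant

end Summit.CriticalPhenomena.PercolationContinuityZ3.Theorems
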